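import Literature.MathematicalPhysics.QuantumFieldTheory.Balaban1983to89.Step

/-!
# `Balaban1983to89.B12RGEquation018` — [Balaban1987RG1] p. 255, the remark after (0.18): the renormalization group
equation (0.18)/(0.20) «is a finite difference approximation … of the differential equation (d/ds)(1/g²) = −β(g), or
(dg/ds) = ½β(g)g³» — the equivalence of the two printed differential forms and the finite-difference/FTC identity,
PROVED (elementary calculus)

HONEST FRAMING (cell `lit-balaban`, verbatim): statement-level skeleton of published theorems with citation tags; proofs
where landed; nothing here is a claim about the Yang–Mills mass gap.

CITATION HEADER.  T. Bałaban, *Renormalization group approach to lattice gauge field theories. I. Generation of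
effective actions in a small field approximation and a coupling constant renormalization in four dimensions*,
Commun. Math. Phys. **109** (1987) 249–301, doi:10.1007/bf01215223 [Balaban1987RG1] (cell paper B12; held text
`paper:balaban1987-cmp109-rg-i-small-field`, journal page = PDF page + 248; p. 255 read from the render
`b2b-balaban-ref1/pages/1987-cmp109-rg-I-small-field/…-p007-x2.png`).  Unit `lit-balaban-r09` gen 7 (reader/typer of
B12, Phase 2), SKELETON row `B12.Eq0.18` (typed-existing: (0.18)/(0.20) = `Step.RGEq`, `Setup.Flow.SatisfiesRG`,
`Step.rgEq_iff`, telescoping `Step.inv_sq_telescope`).  The p. 255 sentence below was so far quoted only as MOTIVATION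
(in `T4BetaStationary`, `T4ContinuumLambda`: «used by NO declaration»); this file proves its elementary content.

WHAT IS PRINTED (verbatim, p. 255 [PDF 7], after (0.18) «1/g₀² = 1/g₁² + β₁(g₀), or 1/g₁² = 1/g₀² − β₁(g₀). (0.18)»).
*«The equation (0.18) written in the form (1/g₁²) − (1/g₀²) = (d(1/g²))₀ = −β₁(g₀) is a finite difference
approximation, corresponding to two consecutive lattice spacings (on a logarithmic scale) of the differential equation
(d/ds)(1/g²) = −β(g), or (dg/ds) = ½β(g)g³. This is the usual differential renormalization group equation, an example
of a Callan-Symanzik equation, considered in quantum field theory.»*  (Here the printed (0.18) has the sign convention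
`1/g₀² = 1/g₁² + β₁(g₀)`, i.e. `1/g₁² − 1/g₀² = −β₁(g₀)`; (0.20) p. 256 is the same at step `k`: `1/g_k² = 1/g_{k+1}² +
β_{k+1}(g_k)` = `Step.RGEq`.)

WHAT IS FORMALIZED.
 §1  `hasDerivAt_inv_sq`: along a differentiable trajectory `g` with `g(s) ≠ 0`, `(d/ds)(1/g²) = −2g′/g³`; hence
     **`ode_forms_iff`**: `(d/ds)(1/g²)(s) = −b ⇔ g′(s) = ½·b·g(s)³` — the two printed forms of the differential
     equation are the same equation (`b = β(g(s))`).
 §2  **`inv_sq_sub_eq_neg_integral`**: if `(d/dσ)(1/g²) = −β(g(σ))` on `[a, a′]` then `1/g(a′)² − 1/g(a)² =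
     −∫_a^{a′} β(g(σ))dσ` (FTC); at unit step (`a′ = a + 1`: «two consecutive lattice spacings on a logarithmic scale»,
     `s = log_L` of the scale) this is the exact counterpart of the printed `(1/g₁²) − (1/g₀²) = −β₁(g₀)`, which replaces
     the integral by the value at the left end point (`rgEq_difference_form`: the discrete side, from `Step.RGEq`).
 §3  **`euler_defect_le`**: the defect of that replacement over one step is `≤ K/2` when `σ ↦ β(g(σ))` moves by at most
     `K(σ − s)` on the step (the standard one-step estimate of the explicit Euler scheme) — the precise sense of «finite
     difference approximation».
 §4  `inv_sq_window`: if `b ≤ β(g(σ)) ≤ b′` along the trajectory then `1/g(a+T)² + b·T ≤ 1/g(a)² ≤ 1/g(a+T)² + b′·T`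
     (the finer-scale value `1/g(a)²` exceeds the coarser one `1/g(a+T)²` by between `bT` and `b′T`; v1.2: this header
     line had the two members exchanged in v1.0–v1.1, the theorem and its docstring were always as here — referee ref-1
     g26) — the continuum counterpart of the two-sided logarithmic bound (0.31) of Theorem 2 (whose discrete reduction from
     bounds on the `β_k` is `Step`'s telescoping); recorded for orientation only.

WHAT IS *NOT* CLAIMED.  Nothing about Bałaban's β-functions (a SEQUENCE `β_k` of functions of the coupling history,
p. 255 «This is a function in a sequence of β-functions», p. 298) is asserted: `β`, `g` below are arbitrary real functions.
No convergence of the discrete flow to an ODE solution is claimed (that would need the unprinted regularity of the `β_k`,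
MISSING-SOURCES M-r09-2).  [folklore] calculus throughout; no `Prop`-valued fact; axioms standard.

v1.1 (unit `lit-balaban-r09` gen 10, 2026-08-21; DOCFIX ONLY — no declaration, statement or proof changed): the two
quotations of p. 255 above and in `rgEq_difference_form` corrected to print's orientation and glyphs — (0.18) reads
«1/g₀² = 1/g₁² + β₁(g₀), or 1/g₁² = 1/g₀² − β₁(g₀)» (v1.0 had `g₀ ↔ g₁` exchanged in both members of the quoted display)
and the sentence has «(d(1/g²))₀» (v1.0: «(∂(1/g²))₀»); quotation finding D-K16-2 of the pub-balaban β-flow typer 2,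
re-read on the 600-dpi crop `pub-balaban/b2b-balaban-beta-erice-lit2/g13/cmp109_p255_eq018_x2.png`.  Every theorem of
v1.0 already carried the printed orientation (`rgEq_difference_form`: `1/g_{k+1}² − 1/g_k² = −β_{k+1}(g_k)`).

v1.2 (unit `lit-balaban-r09` gen 10, 2026-08-21; DOCFIX ONLY — no declaration, statement or proof changed): the module
header's §4 summary line of `inv_sq_window` now states the window in the theorem's (correct) orientation
`1/g(a+T)² + bT ≤ 1/g(a)² ≤ 1/g(a+T)² + b′T` (referee ref-1 g26 ROW-SIGNED note, 2026-08-21T13:22:32Z).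
-/

namespace Literature.MathematicalPhysics.QuantumFieldTheory.Balaban1983to89.B12RGEquation018

open Real MeasureTheory intervalIntegral Set

/-! ## §1  The two printed forms of the differential renormalization group equation -/

/-- Along a trajectory `g` differentiable at `s` with `g(s) ≠ 0`: `(d/ds)(1/g²) = −2g′(s)/g(s)³`.
[cite: Balaban1987RG1, (0.18) p.255] (elementary calculus; our proof) -/
theorem hasDerivAt_inv_sq {g : ℝ → ℝ} {g' s : ℝ} (hg : HasDerivAt g g' s) (hs : g s ≠ 0) :
    HasDerivAt (fun σ => 1 / g σ ^ 2) (-(2 * g' / g s ^ 3)) s := by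
  have h := (hg.pow 2).inv (pow_ne_zero 2 hs)
  have hfun : (fun σ => 1 / g σ ^ 2) = fun σ => (g σ ^ 2)⁻¹ := by
    funext σ; rw [one_div]
  rw [hfun]
  refine h.congr_deriv ?_
  simp only [Pi.pow_apply]
  field_simp
  ring

/-- **The two printed forms are one equation**: *«(d/ds)(1/g²) = −β(g), or (dg/ds) = ½β(g)g³»* — for `g` differentiable
at `s` with derivative `g′` and `g(s) ≠ 0`, `1/g²` has derivative `−b` at `s` iff `g′ = ½·b·g(s)³` (apply with
`b = β(g(s))`). [cite: Balaban1987RG1, (0.18) p.255] -/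
theorem ode_forms_iff {g : ℝ → ℝ} {g' b s : ℝ} (hg : HasDerivAt g g' s) (hs : g s ≠ 0) :
    HasDerivAt (fun σ => 1 / g σ ^ 2) (-b) s ↔ g' = 1 / 2 * b * g s ^ 3 := by
  have hD := hasDerivAt_inv_sq hg hs
  have h3 : g s ^ 3 ≠ 0 := pow_ne_zero 3 hs
  constructor
  · intro h
    have huniq : -(2 * g' / g s ^ 3) = -b := hD.unique h
    have h1 : 2 * g' / g s ^ 3 = b := by linarith
    rw [div_eq_iff h3] at h1
    linarith
  · intro h
    refine hD.congr_deriv ?_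
    rw [h]
    field_simp

/-- The same equivalence phrased with `deriv`: if `g` is differentiable at `s` and `g(s) ≠ 0`, then
`deriv (1/g²) s = −β(g(s)) ↔ deriv g s = ½β(g(s))g(s)³`. [cite: Balaban1987RG1, (0.18) p.255] -/
theorem deriv_forms_iff {g β : ℝ → ℝ} {s : ℝ} (hg : DifferentiableAt ℝ g s) (hs : g s ≠ 0) :
    deriv (fun σ => 1 / g σ ^ 2) s = -β (g s) ↔ deriv g s = 1 / 2 * β (g s) * g s ^ 3 := by
  have hD := hasDerivAt_inv_sq hg.hasDerivAt hs
  rw [hD.deriv]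
  have h3 : g s ^ 3 ≠ 0 := pow_ne_zero 3 hs
  constructor
  · intro h
    have h1 : 2 * deriv g s / g s ^ 3 = β (g s) := by linarith
    rw [div_eq_iff h3] at h1
    linarith
  · intro h
    rw [h]
    field_simp

/-! ## §2  The finite-difference form: (0.18)/(0.20) versus the integrated differential equation -/

/-- **The discrete side, as printed**: the renormalization group equations (0.18)/(0.20) (`Step.RGEq`:
`1/g_k² = 1/g_{k+1}² + β_{k+1}(g_k)`) written in the form *«(1/g₁²) − (1/g₀²) = (d(1/g²))₀ = −β₁(g₀)»* — the forward
difference of `1/g²` over one step of the logarithmic scale equals minus the β-function at the left end point.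
[cite: Balaban1987RG1, (0.18) p.255] -/
theorem rgEq_difference_form {K : ℕ} {β : ℕ → ℝ → ℝ} {g : ℕ → ℝ} (h : Step.RGEq K β g) {k : ℕ} (hk : k < K) :
    1 / g (k + 1) ^ 2 - 1 / g k ^ 2 = -β (k + 1) (g k) := by
  have := h k hk
  linarith

/-- **The continuum side**: if `1/g²` has derivative `−β(g(σ))` at every `σ` of `[a, a′]` and `σ ↦ β(g(σ))` is interval
integrable there, then `1/g(a′)² − 1/g(a)² = −∫_a^{a′} β(g(σ)) dσ` (fundamental theorem of calculus).  With `a′ = a + 1`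
(two consecutive lattice spacings `L^kε`, `L^{k+1}ε` are one unit apart in `s = log_L`) this is the identity of which
the printed `(1/g₁²) − (1/g₀²) = −β₁(g₀)` is the left-end-point («finite difference») approximation.
[cite: Balaban1987RG1, (0.18) p.255] -/
theorem inv_sq_sub_eq_neg_integral {g β : ℝ → ℝ} {a a' : ℝ}
    (hderiv : ∀ σ ∈ uIcc a a', HasDerivAt (fun σ => 1 / g σ ^ 2) (-β (g σ)) σ)
    (hint : IntervalIntegrable (fun σ => β (g σ)) volume a a') :
    1 / g a' ^ 2 - 1 / g a ^ 2 = -∫ σ in a..a', β (g σ) := by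
  have h := integral_eq_sub_of_hasDerivAt hderiv hint.neg
  rw [intervalIntegral.integral_neg] at h
  linarith

/-- Unit-step form: `1/g(s+1)² = 1/g(s)² − ∫_s^{s+1} β(g(σ)) dσ` — compare (0.18): `1/g₁² = 1/g₀² − β₁(g₀)`.
[cite: Balaban1987RG1, (0.18) p.255] -/
theorem inv_sq_step {g β : ℝ → ℝ} {s : ℝ}
    (hderiv : ∀ σ ∈ uIcc s (s + 1), HasDerivAt (fun σ => 1 / g σ ^ 2) (-β (g σ)) σ)
    (hint : IntervalIntegrable (fun σ => β (g σ)) volume s (s + 1)) :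
    1 / g (s + 1) ^ 2 = 1 / g s ^ 2 - ∫ σ in s..(s + 1), β (g σ) := by
  have h := inv_sq_sub_eq_neg_integral hderiv hint
  linarith

/-! ## §3  «Finite difference approximation»: the one-step defect of the left-end-point rule -/

/-- `∫_s^{s+1} K(σ − s) dσ = K/2`. [cite: Balaban1987RG1, (0.18) p.255] (elementary; our proof) -/
theorem integral_linear_step (s K : ℝ) : ∫ σ in s..(s + 1), K * (σ - s) = K / 2 := by
  have h := intervalIntegral.integral_comp_sub_right (a := s) (b := s + 1) (fun x : ℝ => x) s
  simp only [sub_self, add_sub_cancel_left] at h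
  rw [intervalIntegral.integral_const_mul, h, integral_id]
  ring

/-- **One-step defect of the finite-difference approximation**: if `1/g²` solves `(d/dσ)(1/g²) = −β(g(σ))` on
`[s, s+1]`, `σ ↦ β(g(σ))` is continuous there, and `|β(g(σ)) − β(g(s))| ≤ K(σ − s)` for `σ ∈ [s, s+1]` (e.g. `σ ↦ β(g(σ))`
`K`-Lipschitz), then the exact increment differs from the printed left-end-point rule `−β(g(s))` by at most `K/2`:
`|(1/g(s+1)² − 1/g(s)²) − (−β(g(s)))| ≤ K/2`. [cite: Balaban1987RG1, (0.18) p.255] (the standard explicit-Euler estimate; our proof) -/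
theorem euler_defect_le {g β : ℝ → ℝ} {s K : ℝ}
    (hderiv : ∀ σ ∈ uIcc s (s + 1), HasDerivAt (fun σ => 1 / g σ ^ 2) (-β (g σ)) σ)
    (hcont : ContinuousOn (fun σ => β (g σ)) (uIcc s (s + 1)))
    (hLip : ∀ σ ∈ Icc s (s + 1), |β (g σ) - β (g s)| ≤ K * (σ - s)) :
    |(1 / g (s + 1) ^ 2 - 1 / g s ^ 2) - (-β (g s))| ≤ K / 2 := by
  have hs1 : s ≤ s + 1 := by linarith
  have hint : IntervalIntegrable (fun σ => β (g σ)) volume s (s + 1) := hcont.intervalIntegrable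
  have hstep := inv_sq_sub_eq_neg_integral hderiv hint
  -- the defect is the integral of `β(g(s)) − β(g(σ))`
  have hconst : ∫ _ in s..(s + 1), β (g s) = β (g s) := by
    rw [intervalIntegral.integral_const]; simp
  have hdef : (1 / g (s + 1) ^ 2 - 1 / g s ^ 2) - (-β (g s)) = ∫ σ in s..(s + 1), (β (g s) - β (g σ)) := by
    rw [intervalIntegral.integral_sub intervalIntegrable_const hint, hconst, hstep]
    ring
  rw [hdef]
  have hbound : ‖∫ σ in s..(s + 1), (β (g s) - β (g σ))‖ ≤ ∫ σ in s..(s + 1), K * (σ - s) := by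
    refine intervalIntegral.norm_integral_le_of_norm_le hs1 (Filter.Eventually.of_forall fun σ hσ => ?_) ?_
    · rw [Real.norm_eq_abs, abs_sub_comm]
      exact hLip σ (Ioc_subset_Icc_self hσ)
    · exact (continuous_const.mul (continuous_id.sub continuous_const)).intervalIntegrable _ _
  rw [integral_linear_step] at hbound
  simpa [Real.norm_eq_abs] using hbound

/-! ## §4  Orientation: integrated two-sided bounds (the continuum counterpart of (0.31)) -/

/-- If `1/g²` solves `(d/dσ)(1/g²) = −β(g(σ))` on `[a, a+T]` (`T ≥ 0`; `σ` increasing towards COARSER scales, the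
orientation of (0.18)), `σ ↦ β(g(σ))` is continuous there and `b ≤ β(g(σ)) ≤ b′`, then
`1/g(a+T)² + bT ≤ 1/g(a)² ≤ 1/g(a+T)² + b′T`: the finer-scale value `1/g(a)²` exceeds the coarser one by between `bT` and
`b′T`.  With `a + T` the unit scale and `T = log_L(L^kε)⁻¹` this is the continuum analogue of the two-sided logarithmic
bound (0.31) of Theorem 2, `1/g² + β log(L^kε)⁻¹ ≤ 1/g_k² ≤ 1/g² + β′ log(L^kε)⁻¹` (whose DISCRETE reduction from bounds
on the `β_k` is `Step`'s telescoping); orientation only — nothing about Bałaban's `β_k` is asserted.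
[cite: Balaban1987RG1, (0.31) p.259] (elementary; our proof) -/
theorem inv_sq_window {g β : ℝ → ℝ} {a T b b' : ℝ} (hT : 0 ≤ T)
    (hderiv : ∀ σ ∈ uIcc a (a + T), HasDerivAt (fun σ => 1 / g σ ^ 2) (-β (g σ)) σ)
    (hcont : ContinuousOn (fun σ => β (g σ)) (uIcc a (a + T)))
    (hlo : ∀ σ ∈ Icc a (a + T), b ≤ β (g σ)) (hhi : ∀ σ ∈ Icc a (a + T), β (g σ) ≤ b') :
    1 / g (a + T) ^ 2 + b * T ≤ 1 / g a ^ 2 ∧ 1 / g a ^ 2 ≤ 1 / g (a + T) ^ 2 + b' * T := by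
  have haT : a ≤ a + T := by linarith
  have hint : IntervalIntegrable (fun σ => β (g σ)) volume a (a + T) := hcont.intervalIntegrable
  have hftc : 1 / g (a + T) ^ 2 - 1 / g a ^ 2 = -∫ σ in a..(a + T), β (g σ) :=
    inv_sq_sub_eq_neg_integral hderiv hint
  have hlo' : ∫ _ in a..(a + T), b ≤ ∫ σ in a..(a + T), β (g σ) :=
    intervalIntegral.integral_mono_on haT intervalIntegrable_const hint hlo
  have hhi' : ∫ σ in a..(a + T), β (g σ) ≤ ∫ _ in a..(a + T), b' :=
    intervalIntegral.integral_mono_on haT hint intervalIntegrable_const hhi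
  rw [intervalIntegral.integral_const, smul_eq_mul] at hlo' hhi'
  constructor <;> nlinarith

end Literature.MathematicalPhysics.QuantumFieldTheory.Balaban1983to89.B12RGEquation018
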